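import Summits.BirchSwinnertonDyer.BirchSwinnertonDyer.Theorems.KimAtThreeFineKatoKPortJunctionWild
import Literature.NumberTheory.EllipticCurves.ManinConstantAdditivePrimesProofs
import Literature.NumberTheory.EllipticCurves.FormalGroupChartLimitLogBaseChangeProofs
import Literature.NumberTheory.EllipticCurves.Kato2004.EulerSystemValues
import HarnessLib

/-!
# hLog₀ clause (d) at EVERY level, binder-free: the K-port packages with their model / integrality /
# minimality / ramification side conditions DISCHARGED, and the level arithmetic `3 ∣ cycLevel 3 0 r ↔ v₀ ∈ r`
# (cell `bsd-addord`, seat w2-acc4 gen 5 = owner of the part `hLog₀` of crux 19560; `--supports 19560`, helper)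

HONEST FRAMING. Route W2 (`route-BirchSwinnertonDyer-KimAtThreeKolyvagin`), crux 19560
`KatoKuriharaPortThreeShared`, registered line `perFactorKato` (stub `hKloc`), chain of record
`hKloc ⟸ hKdef₀ ⟸ hKatoV2₀ ∧ hS5a ∧ hLog₀` (kim3 p508902 `perFactorSingle_of_parts`).  The part
**hLog₀** asks, per Kato-stratum row and per level `r : Finset (HeightOneSpectrum (𝓞 ℚ))` and place
`w₀ ∣ 3` of `L = ℚ(ζ_m)`, `m = cycLevel 3 0 r`: (d) a set `Λ₀ ⊆ 𝒪_{w₀} ∋ 0` with ONE element of unit trace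
`‖e₃⁻¹ Tr_{L_{w₀}/ℚ_v} ℓ₀‖ = 1`, and (e) duality-integrality against the defined `exp*_{w₀}`.  Clause (d) is in
the tree as w2-kport's `KPort.clause_d_unit_package` (TAME levels `3 ∤ m`) and w2-acc4's
`KPort.clause_d_unit_package_wild` (WILD levels `m = 3·m′`, road (R-b)) — both stated, like every K-port
file, under the DISPLAYED instance binders `[hE] [hX] [hX′] [hmin]` (the `ℤ₃`-model
`M_W := (integralModelInt W) ⊗ ℤ₃` is elliptic / `ℤ₃`-integral / `𝒪_{‖·‖}`-integral / minimal), `[hint]`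
(`M_W ⊗ K` is `𝒪_K`-integral) and `[Fact (e(w∣3) = 1)]`.  hLog₀ carries none of these, so its supplier must
discharge them.  THIS FILE does so (§1: `isMinimal_map_coe_integralModelInt`,
`isIntegral_padicInt_map_coe_integralModelInt`, `isIntegral_valuationInteger_map_coe_integralModelInt`, with
`Additive.isElliptic_map_coe_integralModelInt`, `BallEval.isIntegral_curveK`,
`Kw.ramificationIdx_eq_one_of_isCyclotomicExtension` from the tree), proves the level arithmetic the case
split needs (§2: `three_dvd_cycLevel_zero_iff`, `cycLevel_zero_eq_three_mul_erase`,
`not_three_dvd_cycLevel_zero_erase`, `not_three_dvd_cycLevel_zero`), and re-exports the two packages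
BINDER-FREE (§3: `clause_d_unit_package_tame'`, `clause_d_unit_package_wild'` — only the row data
`W, hadd, ht`, the level data and the place remain).  What is then left of hLog₀ is clause (e) alone, i.e. the
displayed residual DUALINT_{w₀} (w2-acc4 FINDING-E / kim3 LEAD 2026-08-27: ⟸ the print fact (S5b-tower) +
kport's (J4) log junction).

TOOL theorems only (no definition, no named fact, no `sorry`); closes nothing by itself; nothing booked; BSD /
19560 are not proved by any of this.

References: J. H. Silverman, *AEC* (2009), VII.1–VII.2, VIII.8 [SilvermanAEC2009]; J. Neukirch, *Algebraic
Number Theory* (1999), Ch. I (10.3)–(10.4), Ch. II (7.12) [NeukirchANT1999]; kim3 memo KIM3-W2-C1c-SEMILOCAL-g14 §7–§8.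
-/

noncomputable section

-- the cell's Theorems namespace `Summit.BirchSwinnertonDyer.BirchSwinnertonDyer.…` repeats the summit name by design (D-0017)
set_option linter.dupNamespace false

open scoped NNReal
open IsDedekindDomain NumberField
open Literature.NumberTheory.AdelicBaseChange

namespace Summit.BirchSwinnertonDyer.BirchSwinnertonDyer.Theorems.KPort

/-! ## §1 The instance side conditions of the K-port packages, discharged -/

section Model

open Summit.BirchSwinnertonDyer.Rank1Residual.Additive Summit.BirchSwinnertonDyer.Rank1Residual.Additive.BallEval
open Literature.NumberTheory.EllipticCurves Literature.NumberTheory.EllipticCurves.Rank1Residual WeierstrassCurve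

variable (W : WeierstrassCurve ℚ) [W.IsElliptic] [W.IsGloballyMinimal]

omit [W.IsElliptic] in
/-- `[hmin]`: the `ℤ₃`-model of a globally minimal `W/ℚ`, read in `ℚ₃`, is a MINIMAL Weierstrass equation
(`map_coe_integralModelInt` + `isMinimal_map_padic_of_isGloballyMinimal`; Silverman VIII.8). -/
theorem isMinimal_map_coe_integralModelInt :
    (((integralModelInt W).map (Int.castRingHom ℤ_[3])).map PadicInt.Coe.ringHom).IsMinimal ℤ_[3] := by
  rw [map_coe_integralModelInt]
  exact isMinimal_map_padic_of_isGloballyMinimal W 3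

omit [W.IsElliptic] in
/-- `[hX]`: the `ℤ₃`-model read in `ℚ₃` is `ℤ₃`-integral (a minimal equation is integral). -/
theorem isIntegral_padicInt_map_coe_integralModelInt :
    (((integralModelInt W).map (Int.castRingHom ℤ_[3])).map PadicInt.Coe.ringHom).IsIntegral ℤ_[3] :=
  haveI := isMinimal_map_coe_integralModelInt W
  inferInstance

omit [W.IsElliptic] in
/-- `[hX′]`: the `ℤ₃`-model read in `ℚ₃` is integral for the valuation ring of `‖·‖` on `ℚ₃`
(`FormalGroupChart.isIntegral_valuationInteger_of_isIntegral_padicInt`). -/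
theorem isIntegral_valuationInteger_map_coe_integralModelInt :
    (((integralModelInt W).map (Int.castRingHom ℤ_[3])).map PadicInt.Coe.ringHom).IsIntegral
      (NormedField.valuation (K := ℚ_[3])).integer :=
  haveI := isIntegral_padicInt_map_coe_integralModelInt W
  FormalGroupChart.isIntegral_valuationInteger_of_isIntegral_padicInt
    (X := ((integralModelInt W).map (Int.castRingHom ℤ_[3])).map PadicInt.Coe.ringHom)

end Model

/-! ## §2 Level arithmetic: `3 ∣ cycLevel 3 0 r ↔ v₀ ∈ r` -/

section Level

open Literature.NumberTheory.EllipticCurves.Kato2004.EulerSystemValues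

/-- The tame factor of a level: `cycLevel 3 0 r = ∏_{q ∈ r} ℓ_q`. -/
private theorem cycLevel_zero_eq_prod (r : Finset (HeightOneSpectrum (𝓞 ℚ))) :
    cycLevel 3 0 r = ∏ q ∈ r, ((Rat.HeightOneSpectrum.primesEquiv q : Nat.Primes) : ℕ) := by
  rw [cycLevel, pow_zero, one_mul]

/-- The rational prime of the place `v₀ = primesEquiv⁻¹ 3` is `3`. -/
private theorem primesEquiv_v₀ :
    ((Rat.HeightOneSpectrum.primesEquiv ((Rat.HeightOneSpectrum.primesEquiv (R := 𝓞 ℚ)).symm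
      ⟨3, Nat.prime_three⟩) : Nat.Primes) : ℕ) = 3 :=
  congrArg Subtype.val ((Rat.HeightOneSpectrum.primesEquiv (R := 𝓞 ℚ)).apply_symm_apply ⟨3, Nat.prime_three⟩)

/-- **`3 ∣ cycLevel 3 0 r ↔ v₀ ∈ r`**: the level `m(0, r) = ∏_{q∈r} ℓ_q` (a product of DISTINCT primes) is
divisible by `3` exactly when the place `v₀` over `3` is one of the `q`. -/
theorem three_dvd_cycLevel_zero_iff (r : Finset (HeightOneSpectrum (𝓞 ℚ))) :
    3 ∣ cycLevel 3 0 r ↔ (Rat.HeightOneSpectrum.primesEquiv (R := 𝓞 ℚ)).symm ⟨3, Nat.prime_three⟩ ∈ r := by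
  rw [cycLevel_zero_eq_prod, Prime.dvd_finsetProd_iff Nat.prime_three.prime]
  constructor
  · rintro ⟨q, hq, hdvd⟩
    have h3 : ((Rat.HeightOneSpectrum.primesEquiv q : Nat.Primes) : ℕ) = 3 :=
      ((Nat.prime_dvd_prime_iff_eq Nat.prime_three (Rat.HeightOneSpectrum.primesEquiv q).2).mp hdvd).symm
    have hq' : q = (Rat.HeightOneSpectrum.primesEquiv (R := 𝓞 ℚ)).symm ⟨3, Nat.prime_three⟩ := by
      rw [Equiv.eq_symm_apply]
      exact Subtype.ext h3
    rwa [← hq']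
  · intro h
    exact ⟨_, h, by rw [primesEquiv_v₀]⟩

open scoped Classical in
/-- At a wild level the tame part is the level of `r ∖ {v₀}`: **`cycLevel 3 0 r = 3 · cycLevel 3 0 (r.erase v₀)`**
for `v₀ ∈ r`. -/
theorem cycLevel_zero_eq_three_mul_erase {r : Finset (HeightOneSpectrum (𝓞 ℚ))}
    (hr : (Rat.HeightOneSpectrum.primesEquiv (R := 𝓞 ℚ)).symm ⟨3, Nat.prime_three⟩ ∈ r) :
    cycLevel 3 0 r =
      3 * cycLevel 3 0 (r.erase ((Rat.HeightOneSpectrum.primesEquiv (R := 𝓞 ℚ)).symm ⟨3, Nat.prime_three⟩)) := by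
  rw [cycLevel_zero_eq_prod, cycLevel_zero_eq_prod, ← Finset.mul_prod_erase r _ hr, primesEquiv_v₀]

open scoped Classical in
/-- **`3 ∤ cycLevel 3 0 (r.erase v₀)`**: the tame part of a level is prime to `3`. -/
theorem not_three_dvd_cycLevel_zero_erase (r : Finset (HeightOneSpectrum (𝓞 ℚ))) :
    ¬ 3 ∣ cycLevel 3 0 (r.erase ((Rat.HeightOneSpectrum.primesEquiv (R := 𝓞 ℚ)).symm ⟨3, Nat.prime_three⟩)) := by
  rw [three_dvd_cycLevel_zero_iff]
  exact Finset.notMem_erase _ _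

/-- `3 ∤ cycLevel 3 0 r` when `v₀ ∉ r` (the tame levels). -/
theorem not_three_dvd_cycLevel_zero {r : Finset (HeightOneSpectrum (𝓞 ℚ))}
    (hr : (Rat.HeightOneSpectrum.primesEquiv (R := 𝓞 ℚ)).symm ⟨3, Nat.prime_three⟩ ∉ r) :
    ¬ 3 ∣ cycLevel 3 0 r := by
  rwa [three_dvd_cycLevel_zero_iff]

end Level

/-! ## §3 The two clause-(d) packages, binder-free -/

section Packages

open Summit.BirchSwinnertonDyer.Rank1Residual.Additive Summit.BirchSwinnertonDyer.Rank1Residual.Additive.BallEval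
open Summit.BirchSwinnertonDyer.Rank1Residual.Additive.LocalLog Literature.NumberTheory.EllipticCurves.Rank1Residual
open Literature.NumberTheory.EllipticCurves WeierstrassCurve

variable {L : Type} [Field L] [NumberField L]

open scoped Classical in
/-- **hLog₀ clause (d) at a TAME level, binder-free.**  For `L/ℚ` `{m}`-cyclotomic with `3 ∤ m`, any place
`w ∣ 3` of `L`, and a Kato-stratum row (`W/ℚ` globally minimal, `Addv W 3`, `#E(ℚ₃)[3] = 1`): w2-kport's
`clause_d_unit_package` for `Λ₀ʷ := {toCompletion (satLog P) : P ∈ E₀(K_w)}` with `[hE] [hX] [hX′] [hmin] [hint]`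
and `Fact (e(w∣3) = 1)` DISCHARGED (§1, `BallEval.isIntegral_curveK`, `Kw.ramificationIdx_eq_one_of_isCyclotomicExtension`). -/
theorem clause_d_unit_package_tame' (m : ℕ) [NeZero m] [IsCyclotomicExtension {m} ℚ L] (hm : ¬ 3 ∣ m)
    (w : ((Rat.HeightOneSpectrum.primesEquiv (R := 𝓞 ℚ)).symm ⟨3, Fact.out⟩).Extension (𝓞 L))
    (W : WeierstrassCurve ℚ) [W.IsElliptic] [W.IsGloballyMinimal] (hadd : Addv W 3)
    (ht : Nat.card {Q : (W.baseChange ℚ_[3]).toAffine.Point // (3 : ℕ) • Q = 0} = 1) :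
    haveI : Fact (w.1.asIdeal.ramificationIdx (𝓞 ℚ) = 1) :=
      ⟨Kw.ramificationIdx_eq_one_of_isCyclotomicExtension m hm⟩
    haveI := isIntegral_curveK 3 (Kw 3 L w) ((integralModelInt W).map (Int.castRingHom ℤ_[3]))
    ({x : w.1.adicCompletion L | ∃ P ∈ (((integralModelInt W).map (Int.castRingHom ℤ_[3])).map
          (coeffHom 3 (Kw 3 L w))).nonsingularReductionSubgroup
          (Valuation.integer.integers (NormedField.valuation (K := Kw 3 L w))),
        Kw.toCompletion 3 L w (satLog 3 (Kw 3 L w) ((integralModelInt W).map (Int.castRingHom ℤ_[3])) P) = x} ⊆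
      w.1.adicCompletionIntegers L) ∧
    ((0 : w.1.adicCompletion L) ∈
      {x : w.1.adicCompletion L | ∃ P ∈ (((integralModelInt W).map (Int.castRingHom ℤ_[3])).map
          (coeffHom 3 (Kw 3 L w))).nonsingularReductionSubgroup
          (Valuation.integer.integers (NormedField.valuation (K := Kw 3 L w))),
        Kw.toCompletion 3 L w (satLog 3 (Kw 3 L w) ((integralModelInt W).map (Int.castRingHom ℤ_[3])) P) = x}) ∧
    (∃ ℓ₀ ∈ {x : w.1.adicCompletion L | ∃ P ∈ (((integralModelInt W).map (Int.castRingHom ℤ_[3])).map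
          (coeffHom 3 (Kw 3 L w))).nonsingularReductionSubgroup
          (Valuation.integer.integers (NormedField.valuation (K := Kw 3 L w))),
        Kw.toCompletion 3 L w (satLog 3 (Kw 3 L w) ((integralModelInt W).map (Int.castRingHom ℤ_[3])) P) = x},
      ‖(Padic.adicCompletionEquiv (𝓞 ℚ) ⟨3, Fact.out⟩).symm
          (Algebra.trace (((Rat.HeightOneSpectrum.primesEquiv (R := 𝓞 ℚ)).symm ⟨3, Fact.out⟩).adicCompletion ℚ)
            (w.1.adicCompletion L) ℓ₀)‖ = 1) := by
  haveI : Fact (w.1.asIdeal.ramificationIdx (𝓞 ℚ) = 1) :=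
    ⟨Kw.ramificationIdx_eq_one_of_isCyclotomicExtension m hm⟩
  haveI := isElliptic_map_coe_integralModelInt W 3
  haveI := isIntegral_padicInt_map_coe_integralModelInt W
  haveI := isIntegral_valuationInteger_map_coe_integralModelInt W
  haveI := isMinimal_map_coe_integralModelInt W
  haveI := isIntegral_curveK 3 (Kw 3 L w) ((integralModelInt W).map (Int.castRingHom ℤ_[3]))
  exact clause_d_unit_package w m W hadd ht

variable {F : Type} [Field F] [NumberField F] [Algebra F L] [IsScalarTower ℚ F L]

open scoped Classical in
/-- **hLog₀ clause (d) at a WILD level `m = 3·m′`, binder-free.**  For `L/ℚ` `{3·m′}`-cyclotomic with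
`3 ∤ m′`, a subfield `F ⊆ L` `{m′}`-cyclotomic, places `w ∣ u ∣ 3` (`w ∩ 𝓞 F = u`) and a Kato-stratum row:
w2-acc4's `clause_d_unit_package_wild` for `Λ₀ʷ := ι '' {toCompletion (satLog P) : P ∈ E₀(K_u)}`,
`ι : F_u → L_w` the packet's map, with every instance side condition DISCHARGED. -/
theorem clause_d_unit_package_wild' (m' : ℕ) [NeZero m'] [IsCyclotomicExtension {3 * m'} ℚ L]
    [IsCyclotomicExtension {m'} ℚ F] (hm' : ¬ 3 ∣ m')
    (u : ((Rat.HeightOneSpectrum.primesEquiv (R := 𝓞 ℚ)).symm ⟨3, Fact.out⟩).Extension (𝓞 F))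
    (w : ((Rat.HeightOneSpectrum.primesEquiv (R := 𝓞 ℚ)).symm ⟨3, Fact.out⟩).Extension (𝓞 L))
    (hwu : w.1.under (𝓞 F) = u.1)
    (W : WeierstrassCurve ℚ) [W.IsElliptic] [W.IsGloballyMinimal] (hadd : Addv W 3)
    (ht : Nat.card {Q : (W.baseChange ℚ_[3]).toAffine.Point // (3 : ℕ) • Q = 0} = 1) :
    haveI : Fact (u.1.asIdeal.ramificationIdx (𝓞 ℚ) = 1) :=
      ⟨Kw.ramificationIdx_eq_one_of_isCyclotomicExtension m' hm'⟩
    haveI := isIntegral_curveK 3 (Kw 3 F u) ((integralModelInt W).map (Int.castRingHom ℤ_[3]))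
    (HeightOneSpectrum.Extension.adicCompletionSemialgHom F L (⟨w.1, hwu⟩ : u.1.Extension (𝓞 L)) ''
        {x : u.1.adicCompletion F | ∃ P ∈ (((integralModelInt W).map (Int.castRingHom ℤ_[3])).map
          (coeffHom 3 (Kw 3 F u))).nonsingularReductionSubgroup
          (Valuation.integer.integers (NormedField.valuation (K := Kw 3 F u))),
        Kw.toCompletion 3 F u (satLog 3 (Kw 3 F u) ((integralModelInt W).map (Int.castRingHom ℤ_[3])) P) = x} ⊆
      w.1.adicCompletionIntegers L) ∧
    ((0 : w.1.adicCompletion L) ∈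
      HeightOneSpectrum.Extension.adicCompletionSemialgHom F L (⟨w.1, hwu⟩ : u.1.Extension (𝓞 L)) ''
        {x : u.1.adicCompletion F | ∃ P ∈ (((integralModelInt W).map (Int.castRingHom ℤ_[3])).map
          (coeffHom 3 (Kw 3 F u))).nonsingularReductionSubgroup
          (Valuation.integer.integers (NormedField.valuation (K := Kw 3 F u))),
        Kw.toCompletion 3 F u (satLog 3 (Kw 3 F u) ((integralModelInt W).map (Int.castRingHom ℤ_[3])) P) = x}) ∧
    (∃ ℓ₀ ∈ HeightOneSpectrum.Extension.adicCompletionSemialgHom F L (⟨w.1, hwu⟩ : u.1.Extension (𝓞 L)) ''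
        {x : u.1.adicCompletion F | ∃ P ∈ (((integralModelInt W).map (Int.castRingHom ℤ_[3])).map
          (coeffHom 3 (Kw 3 F u))).nonsingularReductionSubgroup
          (Valuation.integer.integers (NormedField.valuation (K := Kw 3 F u))),
        Kw.toCompletion 3 F u (satLog 3 (Kw 3 F u) ((integralModelInt W).map (Int.castRingHom ℤ_[3])) P) = x},
      ‖(Padic.adicCompletionEquiv (𝓞 ℚ) ⟨3, Fact.out⟩).symm
          (Algebra.trace (((Rat.HeightOneSpectrum.primesEquiv (R := 𝓞 ℚ)).symm ⟨3, Fact.out⟩).adicCompletion ℚ)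
            (w.1.adicCompletion L) ℓ₀)‖ = 1) := by
  haveI : Fact (u.1.asIdeal.ramificationIdx (𝓞 ℚ) = 1) :=
    ⟨Kw.ramificationIdx_eq_one_of_isCyclotomicExtension m' hm'⟩
  haveI := isElliptic_map_coe_integralModelInt W 3
  haveI := isIntegral_padicInt_map_coe_integralModelInt W
  haveI := isIntegral_valuationInteger_map_coe_integralModelInt W
  haveI := isMinimal_map_coe_integralModelInt W
  haveI := isIntegral_curveK 3 (Kw 3 F u) ((integralModelInt W).map (Int.castRingHom ℤ_[3]))
  exact clause_d_unit_package_wild m' u w hwu hm' W hadd ht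

end Packages

end Summit.BirchSwinnertonDyer.BirchSwinnertonDyer.Theorems.KPort

end
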